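import Literature.MathematicalPhysics.PowerSystems.DCFlowLineOutageUpdate
import Literature.Probability.MarkovChains.FosterTheorem
import HarnessLib

/-!
# DC power flow under a single line outage, IV: the line-to-line transfer-factor matrix is a
# projection of trace `n − 1` (Spielman–Srivastava's `Π = W^{1/2}BL⁺BᵀW^{1/2}`; Foster's theorem) —
# Green's identity, `Σ_ℓ PTDF_k^ℓ·F_ℓ = F_k` for potential flows (idempotence) and `= 0` for
# cycle flows, the self-factor budget
# `Σ_ℓ b_ℓ𝓡_ℓ = n − 1`, the N−1 margin budget `Σ_ℓ (1 − b_ℓ𝓡_ℓ) = m − n + 1`, Markov counts of stiff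
# lines, «every line critical ⟺ tree», and the Joule heat of a redistribution `= F_ℓ²·𝓡'_ℓ`

Topic `Literature/MathematicalPhysics/PowerSystems`; namespaces `…PowerSystems.KronReduction` (§1–§4)
and `…PowerSystems.ClassicalModel` (§5, the DC power-flow model).  Fifth file of the DC line-outage
story (`DCFlowLineOutageFactor.lean`: transfer potentials `Lv = e_a − e_b`, `𝓡(a ↔ b) = v_a − v_b`,
reciprocity, PTDF `= b_mn(v_m − v_n)`, self-factor `b𝓡 ≤ 1`, `< 1` off bridges;
`DCFlowLineOutageBounds.lean`: `b𝓡 = 1 ⟺` bridge; `DCFlowLineOutageUpdate.lean`: post-outage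
resistances).  The tree's `Literature.Probability.MarkovChains.LyonsPeres2016_ex_4_29` is FOSTER'S
THEOREM `½Σ_xΣ_y c(x,y)𝓡(x ↔ y) = n − 1` for an irreducible network; this file transports it to the
connected-graph hypothesis of the power-systems files and reads it, with Spielman–Srivastava's Lemma 3,
in the PTDF / LODF vocabulary of N−1 security analysis.  Everything below is PROVED: 0 definitions,
0 named facts, 0 `sorry`, no new axiom.

SOURCES (read on the page).
* [SpielmanSrivastava2011] arXiv:0803.0929 §2.1 (p0005 L5–L16): `L = BᵀWB`, `B` the signed
  edge-vertex incidence matrix, `W = diag(w_e)`, `b_{(u,v)}ᵀ = χ_v − χ_u`; §2.2 (p0005 L81–L91): «To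
  inject and extract a unit current across the endpoints of an edge `e = (u,v)`, we set `i_ext = b_eᵀ`
  … `v = L⁺b_eᵀ` … the matrix `BL⁺Bᵀ` has as its diagonal entries `BL⁺Bᵀ(e,e) = R_e`»; §3 (p0006
  L3–L11): «Consider the matrix `Π = W^{1/2}BL⁺BᵀW^{1/2}` … the diagonal entries of `Π` are `Π(e,e) =
  w_eR_e`.  **Lemma 3 (Projection Matrix).** (i) `Π` is a projection matrix. (ii) `im(Π) = im(W^{1/2}B)`.
  (iii) The eigenvalues of `Π` are `1` with multiplicity `n − 1` and `0` with multiplicity `m − n + 1`.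
  (iv) `Π(e,e) = ‖Π(·,e)‖²`»; its proof (p0006 L13–L47: «`Π² = … = W^{1/2}BL⁺LL⁺BᵀW^{1/2}` …»,
  «`dim(im(Π)) = n − 1` … it must have exactly `n − 1` nonzero eigenvalues», «(iv) follows from
  `Π²(e,e) = Π(·,e)ᵀΠ(·,e)`, since `Π` is symmetric»); and the use made of (iii) (p0006 L135–L137):
  «Since `Σ_e w_eR_e = Tr(Π) = n − 1` by Lemma 3 (iii)».
* [LyonsPeres2016] §4.6 Exercise 4.29 / §2.11 Exercise 2.65 (Foster's Theorem, Foster 1948) — in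
  the tree as `LyonsPeres2016_ex_4_29` (network form `½ΣΣ c𝓡 = n − 1`, irreducible network) and
  `LyonsPeres2016_ex_2_65`; used BY NAME.
* [RonellenfitschEtAl2017] arXiv:1606.07276 §2 (p0004 L70–L95): «`F = B_d Kᵗ B* P`. This matrix
  combination is taken as the definition of the nodal Power Transfer Distribution Factor (PTDF) …
  `LODF_{kℓ} = [PTDF·K]_{kℓ}/(1 − [PTDF·K]_{ℓℓ})` … The matrix `[PTDF·K]_{kℓ}` can be interpreted as
  the sensitivity of the flow on `k` to the injection of one unit of power at the from-node of `ℓ` and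
  the withdrawal of one unit of power at the to-node of `ℓ`»; §3 (p0005 L4–L11): «All such directed
  cycles can be decomposed into a set of `L − N + 1` fundamental cycles … the `L − N + 1` cycles are a
  basis for the kernel of the incidence matrix `K`»; §5.3 (p0008 L31–L32): «One then divides each
  column `ℓ` by the value `1 − PTDF_{ℓℓ}` to obtain the LODFs».
* [StrakeEtAl2019] arXiv:1811.08683 §3.1–§3.2 (p0005): PTDF / LODF through `B†` and `ν_rs` (first
  file).  [GuoEtAl2020] arXiv:2005.10199 §3.2–§3.3 (p0008): `D = BCᵀAC`, `K_{l l̂} = D_{l l̂}/(1 −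
  D_{l̂ l̂})`.  [ColettaJacquod2019 = arXiv:1711.10348] Prop. 7 (p0013 L105–L120, p0015 L17–L22): the
  transient cost of a line contingency is «proportional to the square of the power flowing on the line
  prior to the fault, times a topological factor … equal to the resistance distance» — quoted for the
  READING of §5 only (a different, dynamical measure; nothing of it is typed here).

RENDERING (as in the first file).  Conductance network `c : Matrix X X ℝ` (`IsConductance c`:
symmetric, `≥ 0`, positive node conductances), `L = diagonal (nodeConductance c) − c`, graph
hypothesis `hG : G.Adj x y ↔ x ≠ y ∧ c x y ≠ 0` with `G` connected; ORDERED LINES = pairs `(x,y)`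
with `x ≠ y`, `c x y ≠ 0` (each physical line appears twice; the line finset is written
`univ.filter (fun e : X × X => e.1 ≠ e.2 ∧ c e.1 e.2 ≠ 0)`, of cardinality `2m`,
`card_lines_eq_two_mul_card_edgeFinset`); transfer potentials `hv : L *ᵥ v = Pi.single a 1 −
Pi.single b 1`, and for statements about ALL lines a family `v p q` with this property for every
ordered line `(p,q)` (`exists_transferPotentials`); the LINE-TO-LINE TRANSFER FACTOR of the ordered
line `(m,n)` for the transfer across `(p,q)` is `c m n * (v p q m − v p q n)` (`= [PTDF·K]_{(mn),(pq)}`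
of [RonellenfitschEtAl2017], `D_{l l̂}` of [GuoEtAl2020], `w_m b_m L⁺ b_ℓᵀ = (W^{1/2}ΠW^{−1/2})(m,ℓ)` of
[SpielmanSrivastava2011] — `Π` and the transfer-factor matrix are similar, so «projection», «trace»
and «eigenvalues» transport verbatim); the SELF-FACTOR of a line is `c p q * (v p q p − v p q q) =
c(p,q)𝓡(p ↔ q) = Π(ℓ,ℓ) = PTDF_{ℓℓ}` (`effectiveResistance_eq_transferPotential_sub`), and `1 −
c𝓡` is the LODF denominator.

WHAT IS PROVED (0 `def`, 0 named facts, 0 `sorry`).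
* §1 ★ `laplacian_bilinForm_eq_sum` (GREEN: `uᵀLw = ½ΣΣ c(x,y)(u_x − u_y)(w_x − w_y)`), ★★
  **`sum_conductance_mul_sub_mul_transferPotential_sub`** (`ΣΣ c(x,y)(u_x − u_y)(w_x − w_y) = 2(u_a −
  u_b)` for a transfer potential `w` of `(a,b)` and ANY `u`), ★★ `sum_conductance_mul_transferPotential_sub_sq`
  (energy of the unit transfer `ΣΣ c(v_x − v_y)² = 2𝓡(a ↔ b)` — the diagonal case of Lemma 3 (iv)),
  `exists_transferPotentials`.
* §2 ★★★ **`sum_transferFactor_mul_potentialFlow`** (Lemma 3 (ii) «`Π` is the identity on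
  `im(W^{1/2}B)`» and (i) `Π² = Π` in transfer-factor form: for ANY node function `w`,
  `Σ_pΣ_q [c_mn(v^{pq}_m − v^{pq}_n)]·[c_pq(w_p − w_q)] = 2·c_mn(w_m − w_n)` — the transfer-factor
  matrix reproduces every potential flow (with `w = θ`: `F_k = Σ_ℓ [PTDF·K]_{kℓ}F_ℓ` over physical
  lines; with `w = v^{ab}`: idempotence `Σ_ℓ D_{kℓ}D_{ℓg} = D_{kg}`), the `2` being the double count of
  lines), ★★ **`sum_transferFactor_mul_circulation_eq_zero`** (the complement: divergence-free
  antisymmetric line flows — cycle flows, `KC = 0` — produce no transfer: `Σ_pΣ_q D_{(mn),(pq)}f_pq =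
  0`), ★★ `sum_conductance_mul_transferPotential_sub_sq_off` (Lemma 3 (iv) split off the diagonal:
  over the ordered pairs OTHER than the line itself `ΣΣ' c(v_x − v_y)² = 2𝓡(1 − c𝓡)` — the
  redistribution energy behind the LODF column), ★★ `sum_lodf_sq_div` (non-bridge: `ΣΣ' c[(v_x −
  v_y)/(1 − c𝓡)]² = 2𝓡/(1 − c𝓡)`).
* §3 ★★★ **`sum_conductance_mul_effectiveResistance`** (FOSTER / Lemma 3 (iii) on a connected
  network: `Σ_xΣ_y c(x,y)𝓡(x ↔ y) = 2(n − 1)`), ★★★ **`sum_selfTransferFactor`** (`Σ_pΣ_q c_pq(v^{pq}_p −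
  v^{pq}_q) = 2(n − 1)`: the self-PTDFs of all lines sum to `n − 1`), ★★★ **`sum_lines_selfFactor`** (the
  same over the line finset), ★★ `two_mul_card_sub_one_le_card_lines` (`2(n − 1) ≤ #ordered lines`,
  from Foster and `c𝓡 ≤ 1`), ★★★ **`sum_lines_one_sub_selfFactor`** (THE N−1 MARGIN BUDGET `Σ_ℓ (1 −
  c_ℓ𝓡_ℓ) = #ordered lines − 2(n − 1) = 2(m − n + 1)`, twice the cycle rank — Lemma 3 (iii)'s
  multiplicity of the eigenvalue `0`), ★★ `mul_card_lines_selfFactor_ge_le` (MARKOV COUNT: `t·#{ℓ :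
  t ≤ c_ℓ𝓡_ℓ} ≤ 2(n − 1)`), ★★ `mul_card_lines_margin_le_le` (`(1 − ε)·#{ℓ : 1 − c_ℓ𝓡_ℓ ≤ ε} ≤ 2(n −
  1)`: few lines can have a small LODF denominator).
* §4 ★★★ **`forall_selfFactor_eq_one_iff_isTree`** (EVERY LINE IS CRITICAL — self-factor `1`, no
  finite LODF — iff the grid is a tree), ★★★ **`card_lines_eq_iff_forall_selfFactor_eq_one`** (iff
  Foster's count saturates: `#ordered lines = 2(n − 1)`), ★ `card_lines_eq_two_mul_card_edgeFinset`.
* §5 THE MODEL: ★★★ **`ClassicalModel.dcFlow_lineOutage_redistributionEnergy`** (DC power flow, line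
  `{r,s}` tripped, damaged grid connected: `Σ_mΣ_n c'_mn[(θ'_m − θ'_n) − (θ_m − θ_n)]² = 2F_rs²·𝓡'(r ↔
  s)` and `𝓡'(r ↔ s) = 𝓡(r ↔ s)/(1 − c_rs𝓡(r ↔ s))` — twice the Joule heat `Σ_k ΔF_k²/b_k` of the
  redistributed flow equals `2F_ℓ²` times the post-outage resistance across the tripped terminals).

PROOF ROUTE.  §1 is the summation-by-parts identity `uᵀLw = ½ΣΣc(u_x − u_y)(w_x − w_y)` (symmetry of
`c`) evaluated at `Lw = e_a − e_b`.  §2: reciprocity (`transferPotential_reciprocity`) turns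
`v^{pq}_m − v^{pq}_n` into `v^{mn}_p − v^{mn}_q`, and Green with the potential `v^{mn}` and the test
function `w` gives `2(w_m − w_n)`; against a circulation `f` the same rewriting leaves `Σ_p u_p(Σ_q
f_pq) − Σ_q u_q(Σ_p f_pq) = 0`; the off-diagonal energy is `2𝓡 − 2c𝓡²`.  §3: irreducibility of the
network walk from connectedness (`isIrreducible_networkKernel_of_connected`), then
`LyonsPeres2016_ex_4_29`; the finset forms drop the vanishing terms (`x = y` or `c x y = 0`); the
budget, the lower bound on the number of lines and the Markov counts are Foster plus `0 ≤ c𝓡 ≤ 1`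
(`conductance_mul_effectiveResistance_le_one`).  §4: `c𝓡 = 1 ⟺ ¬Reachable` in `G.deleteEdges
{s(x,y)}` (`conductance_mul_effectiveResistance_lt_one_iff_reachable`) is Mathlib's `IsBridge`, and
`isAcyclic_iff_forall_adj_isBridge`; the count form is the budget with non-negative terms.  §5: `ψ =
θ' − θ` solves `L'ψ = F_rs·ν_rs` on the damaged grid (`dcFlow_lineOutage_transfer`), so `ψ/F_rs` is a
transfer potential of `c'` and §1 gives the energy; `𝓡' = 𝓡/(1 − c𝓡)` is
`effectiveResistance_lineOutage_eq` at `(a,b) = (r,s)`.  DECLARED DEVIATION: the incidence matrix `B`,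
`W^{1/2}` and `L⁺` are never formed — Lemma 3 is typed through its action on transfer potentials
(similar matrix `WBL⁺Bᵀ`), which is what the PTDF literature uses.  In-seat exact cross-check
(`negtest/dcflow_projection_check.py`, python `Fraction`s, seat folder): 60 random connected networks
on 3–7 nodes (every sixth a tree), all ordered pairs: Green, mutual energy, energy `= 2𝓡`,
potential-flow reproduction for random `w`, idempotence, a unit cycle flow against every `(m,n)`,
trace, self-factor sum, line-finset Foster, budget, Markov and margin counts, «all critical ⟺ tree ⟺
count saturates», `c𝓡 = 1 ⟺` bridge (graph search), dart count, off-diagonal energy, LODF² sum, and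
the DC redistribution heat `= 2F²𝓡'` with `𝓡' = 𝓡/(1 − c𝓡)` against DIRECT solves on the damaged
grid — 13 023 checks, 0 failures.

THREE COLUMNS.  CERTIFIED (kernel theorems, exact data): Green's identity; the transfer-factor
matrix reproduces potential flows (idempotence) and kills circulations; `ΣΣ c𝓡 = 2(n − 1)` on
connected networks and its line-finset, budget, counting and tree forms; unit-transfer and
redistribution energies; the DC Joule-heat identity.  MODELLED: DC (linearised, lossless, `|V| ≈ 1`)
power flow with fixed injections; a line outage = deletion of one susceptance with the damaged grid
connected; nothing dynamical, no limits, no protection.  VALIDATED: nothing numerical in Lean.  NOT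
CLAIMED: the matrices `B`, `W^{1/2}`, `L⁺`, `Π` as objects and the spectral statement of Lemma 3 (iii)
as an eigenvalue multiset (only trace, idempotence, range and kernel are typed, through their action),
the dimension count `L − N + 1` of the cycle space itself, the sparsification theorem of
[SpielmanSrivastava2011] (Theorem 1, sampling), the cycle-flow / dual formulas of
[RonellenfitschEtAl2017] (Prop. 1, `M = CA⁻¹Cᵗ`), Coletta–Jacquod's dynamical performance measures,
multiple outages, AC power flow.

## References
* [SpielmanSrivastava2011] D. A. Spielman, N. Srivastava, *Graph sparsification by effective
  resistances*, SIAM J. Comput. 40(6) (2011) 1913–1926, arXiv:0803.0929 — §2.1–§2.2, §3 Lemma 3 and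
  proof of Theorem 1 (p0006 L135–L137).
* [LyonsPeres2016] R. Lyons, Y. Peres, *Probability on Trees and Networks*, CUP 2016 — §2.11
  Exercise 2.65, §4.6 Exercise 4.29 (Foster's theorem; R. M. Foster 1948).
* [RonellenfitschEtAl2017] H. Ronellenfitsch, D. Manik, J. Hörsch, T. Brown, D. Witthaut, *Dual
  theory of transmission line outages*, IEEE Trans. Power Syst. 32 (2017) 4060–4068, arXiv:1606.07276 —
  §2 (PTDF, LODF), §3 (`L − N + 1` fundamental cycles), §5.3.
* [StrakeEtAl2019] J. Strake, F. Kaiser, F. Basiri, H. Ronellenfitsch, D. Witthaut, New J. Phys. 21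
  (2019) 053009, arXiv:1811.08683 — §3.1–§3.2.
* [GuoEtAl2020] L. Guo, C. Liang, A. Zocca, S. H. Low, A. Wierman, *Line failure localization of
  power networks, Part I*, IEEE TPWRS 36 (2021), arXiv:2005.10199 — §3.2–§3.3.
* [LevinPeres2017] D. A. Levin, Y. Peres, *Markov Chains and Mixing Times*, 2nd ed., AMS 2017 —
  §9.4 (conservation of energy, Thomson's principle; tree files `DirichletPrinciple`,
  `ThomsonPrinciple`).
-/

noncomputable section

open scoped Matrix
open Finset Matrix

namespace Literature.MathematicalPhysics.PowerSystems

namespace KronReduction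

open Literature.Probability.MarkovChains

variable {X : Type*} [Fintype X] [DecidableEq X] {c : Matrix X X ℝ}

/-! ### §1. Green's identity and the energy of a transfer -/

section Green

/-- `(L v)_x = Σ_y c(x,y)(v_x − v_y)` for the network Laplacian `L = diag(c(x)) − c`. [folklore] -/
private theorem laplacian_mulVec₁₇ (c : Matrix X X ℝ) (v : X → ℝ) (x : X) :
    ((Matrix.diagonal (nodeConductance c) - c) *ᵥ v) x = ∑ y, c x y * (v x - v y) := by
  rw [Matrix.sub_mulVec, Pi.sub_apply, Matrix.mulVec_diagonal, nodeConductance_def, Matrix.mulVec,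
    dotProduct, Finset.sum_mul, ← Finset.sum_sub_distrib]
  exact Finset.sum_congr rfl fun y _ => by ring

omit [DecidableEq X] in
/-- `uᵀ(e_a − e_b) = u_a − u_b`. [folklore] -/
private theorem dotProduct_nu₁₇ [DecidableEq X] (u : X → ℝ) (a b : X) :
    u ⬝ᵥ (Pi.single a (1 : ℝ) - Pi.single b 1) = u a - u b := by
  rw [dotProduct_sub, dotProduct_single_one, dotProduct_single_one]

/-- ★ **GREEN'S IDENTITY / THE DIRICHLET BILINEAR FORM**: `uᵀLw = ½ Σ_xΣ_y c(x,y)(u_x − u_y)(w_x −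
w_y)` («`xᵀLx = xᵀBᵀWBx = ‖W^{1/2}Bx‖² = Σ_{uv∈E} w_uv(x(u) − x(v))²`», polarised; each line counted
twice in the double sum).
[cite: SpielmanSrivastava2011, §2.1 (arXiv:0803.0929 p0005 L19–L30)] [folklore (summation by parts on a symmetric network)] -/
theorem laplacian_bilinForm_eq_sum (hc : IsConductance c) (u w : X → ℝ) :
    u ⬝ᵥ (Matrix.diagonal (nodeConductance c) - c) *ᵥ w
      = (1 / 2 : ℝ) * ∑ x, ∑ y, c x y * ((u x - u y) * (w x - w y)) := by
  have h1 : u ⬝ᵥ (Matrix.diagonal (nodeConductance c) - c) *ᵥ w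
      = ∑ x, ∑ y, c x y * (u x * (w x - w y)) := by
    rw [dotProduct]
    refine Finset.sum_congr rfl fun x _ => ?_
    rw [laplacian_mulVec₁₇, Finset.mul_sum]
    exact Finset.sum_congr rfl fun y _ => by ring
  have h2 : ∑ x, ∑ y, c x y * (u x * (w x - w y)) = ∑ x, ∑ y, c x y * (u y * (w y - w x)) := by
    rw [Finset.sum_comm]
    exact Finset.sum_congr rfl fun x _ => Finset.sum_congr rfl fun y _ => by rw [hc.symm y x]
  have h3 : ∑ x, ∑ y, c x y * ((u x - u y) * (w x - w y))
      = ∑ x, ∑ y, c x y * (u x * (w x - w y)) + ∑ x, ∑ y, c x y * (u y * (w y - w x)) := by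
    rw [← Finset.sum_add_distrib]
    refine Finset.sum_congr rfl fun x _ => ?_
    rw [← Finset.sum_add_distrib]
    exact Finset.sum_congr rfl fun y _ => by ring
  rw [h1, h3, ← h2]
  ring

/-- ★★ **MUTUAL ENERGY OF A TRANSFER** (Green at `Lw = e_a − e_b`): for a transfer potential `w` of
`(a,b)` and ANY node function `u`, `Σ_xΣ_y c(x,y)(u_x − u_y)(w_x − w_y) = 2(u_a − u_b)` — the unit
current of the transfer `a → b`, paired with any potential, reads off that potential's drop from `a`
to `b`.
[cite: SpielmanSrivastava2011, §2.2 («`i_ext = Bᵀ(WBv) = Lv`», «`v(v) − v(u) = (χ_v − χ_u)ᵀv`», arXiv:0803.0929 p0005 L60–L87)] [folklore] -/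
theorem sum_conductance_mul_sub_mul_transferPotential_sub (hc : IsConductance c) {a b : X}
    {w : X → ℝ} (hw : (Matrix.diagonal (nodeConductance c) - c) *ᵥ w = Pi.single a 1 - Pi.single b 1)
    (u : X → ℝ) :
    ∑ x, ∑ y, c x y * ((u x - u y) * (w x - w y)) = 2 * (u a - u b) := by
  have h := laplacian_bilinForm_eq_sum hc u w
  rw [hw, dotProduct_nu₁₇] at h
  linarith

/-- ★★ **THE ENERGY OF THE UNIT TRANSFER IS THE EFFECTIVE RESISTANCE** (conservation of energy; the
diagonal case `Π(e,e) = ‖Π(·,e)‖² = w_eR_e` of Lemma 3 (iv) divided by `w_e`): for a transfer potential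
`v` of `(a,b)` on a connected network, `Σ_xΣ_y c(x,y)(v_x − v_y)² = 2𝓡(a ↔ b)` (each line twice).
[cite: SpielmanSrivastava2011, §3 Lemma 3 (iv) and §2.2 `BL⁺Bᵀ(e,e) = R_e` (arXiv:0803.0929 p0006 L11, L45–L46; p0005 L90–L91); LevinPeres2017, §9.4 (energy of the unit current flow)] -/
theorem sum_conductance_mul_transferPotential_sub_sq (hc : IsConductance c) {G : SimpleGraph X}
    (hG : ∀ x y, G.Adj x y ↔ x ≠ y ∧ c x y ≠ 0) (hconn : G.Connected) {a b : X} {v : X → ℝ}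
    (hv : (Matrix.diagonal (nodeConductance c) - c) *ᵥ v = Pi.single a 1 - Pi.single b 1) :
    ∑ x, ∑ y, c x y * (v x - v y) ^ 2 = 2 * effectiveResistance c a b := by
  have h := sum_conductance_mul_sub_mul_transferPotential_sub hc hv v
  have h2 : ∑ x, ∑ y, c x y * (v x - v y) ^ 2 = ∑ x, ∑ y, c x y * ((v x - v y) * (v x - v y)) :=
    Finset.sum_congr rfl fun x _ => Finset.sum_congr rfl fun y _ => by rw [sq]
  rcases eq_or_ne a b with rfl | hab
  · rw [h2, h, effectiveResistance_self, sub_self]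
  · rw [h2, h, effectiveResistance_eq_transferPotential_sub hc hG hconn hab hv]

/-- ★ **TRANSFER POTENTIALS FOR ALL ORDERED PAIRS AT ONCE** (a choice of `v^{pq}` with `Lv^{pq} =
e_p − e_q` for every `(p,q)`; the columns `L⁺b_ℓᵀ` up to the slack constant).
[cite: SpielmanSrivastava2011, §2.2 (arXiv:0803.0929 p0005 L81–L84); RonellenfitschEtAl2017, §2 («PTDF `= B_d Kᵗ B*`», arXiv:1606.07276 p0004 L70–L79)] -/
theorem exists_transferPotentials (hc : IsConductance c) {G : SimpleGraph X}
    (hG : ∀ x y, G.Adj x y ↔ x ≠ y ∧ c x y ≠ 0) (hconn : G.Connected) :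
    ∃ v : X → X → X → ℝ, ∀ p q,
      (Matrix.diagonal (nodeConductance c) - c) *ᵥ v p q = Pi.single p 1 - Pi.single q 1 :=
  ⟨fun p q => (exists_transferPotential hc hG hconn p q).choose,
    fun p q => (exists_transferPotential hc hG hconn p q).choose_spec⟩

end Green

/-! ### §2. Lemma 3 (i) and (iv) in transfer-factor form: idempotence, and the redistribution energy
of a line -/

section Projection

/-- ★★★ **THE LINE-TO-LINE TRANSFER-FACTOR MATRIX REPRODUCES EVERY POTENTIAL FLOW AND IS
IDEMPOTENT** (Lemma 3 (ii): «`Π` is the identity on `im(W^{1/2}B)`», the weighted cut space of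
potential differences; Lemma 3 (i): «`Π` is a projection matrix», `Π² = W^{1/2}BL⁺(BᵀWB)L⁺BᵀW^{1/2} =
Π`).  For any family of transfer potentials `v^{pq}` of the ordered lines, ANY node function `w` and
any ordered pair `(m,n)`:
`Σ_pΣ_q [c(m,n)(v^{pq}_m − v^{pq}_n)]·[c(p,q)(w_p − w_q)] = 2·c(m,n)(w_m − w_n)` — composing «the
sensitivity of the flow on `k` to the injection of one unit of power at the from-node of `ℓ` and the
withdrawal … at the to-node of `ℓ`» with the potential flow `c(p,q)(w_p − w_q)` over all ordered lines
`ℓ = (p,q)` returns the potential flow on `(m,n)` (twice: both orientations of a line contribute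
equally; pairs with `p = q` or `c(p,q) = 0` contribute nothing, so only genuine lines need potentials).
With `w = v^{ab}` a transfer potential this is IDEMPOTENCE `Σ_ℓ D_{kℓ}D_{ℓg} = D_{kg}` of the
transfer-factor matrix; with `w = θ` a DC operating point it says that the physical flows are
reproduced, `F_k = Σ_ℓ [PTDF·K]_{kℓ}F_ℓ` (sum over physical lines).
[cite: SpielmanSrivastava2011, §3 Lemma 3 (i)–(ii) with proofs (arXiv:0803.0929 p0006 L7–L8, L13–L37); RonellenfitschEtAl2017, §2 (`[PTDF·K]_{kℓ}`, arXiv:1606.07276 p0004 L88–L95); GuoEtAl2020, §3.2 (`D = BCᵀAC`, arXiv:2005.10199 p0008)] -/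
theorem sum_transferFactor_mul_potentialFlow (hc : IsConductance c) {v : X → X → X → ℝ}
    (hv : ∀ p q, p ≠ q → c p q ≠ 0 →
      (Matrix.diagonal (nodeConductance c) - c) *ᵥ v p q = Pi.single p 1 - Pi.single q 1)
    (w : X → ℝ) (m n : X) :
    ∑ p, ∑ q, (c m n * (v p q m - v p q n)) * (c p q * (w p - w q)) = 2 * (c m n * (w m - w n)) := by
  by_cases hmn : m = n
  · subst hmn; simp
  by_cases hcmn : c m n = 0
  · simp [hcmn]
  have hu := hv m n hmn hcmn
  have key : ∀ p q, (c m n * (v p q m - v p q n)) * (c p q * (w p - w q))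
      = c m n * (c p q * ((w p - w q) * (v m n p - v m n q))) := by
    intro p q
    by_cases hpq : p = q
    · subst hpq; ring
    by_cases hcpq : c p q = 0
    · rw [hcpq]; ring
    · rw [transferPotential_reciprocity hc (hv p q hpq hcpq) hu]; ring
  have hsum : ∑ p, ∑ q, (c m n * (v p q m - v p q n)) * (c p q * (w p - w q))
      = c m n * ∑ p, ∑ q, c p q * ((w p - w q) * (v m n p - v m n q)) := by
    rw [Finset.mul_sum]
    refine Finset.sum_congr rfl fun p _ => ?_
    rw [Finset.mul_sum]
    exact Finset.sum_congr rfl fun q _ => key p q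
  rw [hsum, sum_conductance_mul_sub_mul_transferPotential_sub hc hu w]
  ring

/-- ★★ **CIRCULATIONS PRODUCE NO TRANSFER** (the complement of Lemma 3 (ii): `Π` vanishes on
`(im W^{1/2}B)^⊥`, the cycle space — «the `L − N + 1` cycles are a basis for the kernel of the
incidence matrix `K`, `KC = 0`», hence `[PTDF·K]C = B_dKᵗB*KC = 0`): if `f` is an antisymmetric flow
on the ordered lines (`f(p,q) = −f(q,p)`, `f = 0` off the lines) with zero divergence at every node
(`Σ_q f(p,q) = 0`), then `Σ_pΣ_q [c(m,n)(v^{pq}_m − v^{pq}_n)]·f(p,q) = 0` for every `(m,n)` — cycle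
flows are invisible to the transfer factors (they are fixed by Kirchhoff's voltage law instead).
[cite: RonellenfitschEtAl2017, §3 («`KC = 0`», «Since the cycles form a vector space …», arXiv:1606.07276 p0005 L11–L19), §4 («The flow change `ΔF` thus does not have any source such that it can be decomposed into cycle flows», p0007 L20–L23); SpielmanSrivastava2011, §3 Lemma 3 (ii)–(iii) (arXiv:0803.0929 p0006 L8–L10)] -/
theorem sum_transferFactor_mul_circulation_eq_zero (hc : IsConductance c) {v : X → X → X → ℝ}
    (hv : ∀ p q, p ≠ q → c p q ≠ 0 →
      (Matrix.diagonal (nodeConductance c) - c) *ᵥ v p q = Pi.single p 1 - Pi.single q 1)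
    {f : X → X → ℝ} (hanti : ∀ p q, f p q = - f q p) (hsupp : ∀ p q, c p q = 0 → f p q = 0)
    (hdiv : ∀ p, ∑ q, f p q = 0) (m n : X) :
    ∑ p, ∑ q, (c m n * (v p q m - v p q n)) * f p q = 0 := by
  by_cases hmn : m = n
  · subst hmn; simp
  by_cases hcmn : c m n = 0
  · simp [hcmn]
  have hu := hv m n hmn hcmn
  have key : ∀ p q, (c m n * (v p q m - v p q n)) * f p q = c m n * ((v m n p - v m n q) * f p q) := by
    intro p q
    by_cases hpq : p = q
    · subst hpq
      have h0 : f p p = 0 := by linarith [hanti p p]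
      rw [h0]; ring
    by_cases hcpq : c p q = 0
    · rw [hsupp p q hcpq]; ring
    · rw [transferPotential_reciprocity hc (hv p q hpq hcpq) hu]; ring
  -- `Σ_pΣ_q (u_p − u_q)f_pq = Σ_p u_p(Σ_q f_pq) − Σ_q u_q(Σ_p f_pq) = 0`
  have h2 : ∑ p, ∑ q, v m n p * f p q = 0 :=
    Finset.sum_eq_zero fun p _ => by rw [← Finset.mul_sum, hdiv p, mul_zero]
  have h3 : ∑ p, ∑ q, v m n q * f p q = 0 := by
    rw [Finset.sum_comm]
    refine Finset.sum_eq_zero fun q _ => ?_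
    rw [← Finset.mul_sum]
    have hneg : ∑ p, f p q = - ∑ p, f q p := by
      rw [← Finset.sum_neg_distrib]
      exact Finset.sum_congr rfl fun p _ => hanti p q
    rw [hneg, hdiv q, neg_zero, mul_zero]
  have hsum : ∑ p, ∑ q, (v m n p - v m n q) * f p q = 0 := by
    have h1 : ∑ p, ∑ q, (v m n p - v m n q) * f p q
        = ∑ p, ∑ q, v m n p * f p q - ∑ p, ∑ q, v m n q * f p q := by
      rw [← Finset.sum_sub_distrib]
      refine Finset.sum_congr rfl fun p _ => ?_
      rw [← Finset.sum_sub_distrib]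
      exact Finset.sum_congr rfl fun q _ => by ring
    rw [h1, h2, h3, sub_self]
  calc ∑ p, ∑ q, (c m n * (v p q m - v p q n)) * f p q
      = c m n * ∑ p, ∑ q, (v m n p - v m n q) * f p q := by
        rw [Finset.mul_sum]
        refine Finset.sum_congr rfl fun p _ => ?_
        rw [Finset.mul_sum]
        exact Finset.sum_congr rfl fun q _ => key p q
    _ = 0 := by rw [hsum, mul_zero]

/-- ★★ **THE REDISTRIBUTION ENERGY OF A LINE** (Lemma 3 (iv) with the diagonal term split off:
`Σ_{f ≠ e} Π(f,e)² = Π(e,e) − Π(e,e)² = w_eR_e(1 − w_eR_e)`): for a line `(p,q)` with transfer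
potential `v`, summing `c(x,y)(v_x − v_y)²` over the ordered pairs OTHER than `(p,q)` and `(q,p)` gives
`2𝓡(p ↔ q)(1 − c(p,q)𝓡(p ↔ q))` — the numerators of the LODF column of the line carry exactly the
energy `𝓡(1 − c𝓡)`; it vanishes iff the line is a bridge (`c𝓡 = 1`).
[cite: SpielmanSrivastava2011, §3 Lemma 3 (iv) (arXiv:0803.0929 p0006 L11, L45–L46); RonellenfitschEtAl2017, §2 (LODF column `[PTDF·K]_{kℓ}/(1 − [PTDF·K]_{ℓℓ})`, arXiv:1606.07276 p0004 L88–L92)] -/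
theorem sum_conductance_mul_transferPotential_sub_sq_off (hc : IsConductance c) {G : SimpleGraph X}
    (hG : ∀ x y, G.Adj x y ↔ x ≠ y ∧ c x y ≠ 0) (hconn : G.Connected) {p q : X} (hpq : p ≠ q)
    {v : X → ℝ} (hv : (Matrix.diagonal (nodeConductance c) - c) *ᵥ v = Pi.single p 1 - Pi.single q 1) :
    ∑ x, ∑ y, (if s(x, y) = s(p, q) then 0 else c x y * (v x - v y) ^ 2)
      = 2 * effectiveResistance c p q * (1 - c p q * effectiveResistance c p q) := by
  have htot := sum_conductance_mul_transferPotential_sub_sq hc hG hconn hv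
  have hR := effectiveResistance_eq_transferPotential_sub hc hG hconn hpq hv
  -- the two excluded terms
  have hdiag : ∑ x, ∑ y, (if s(x, y) = s(p, q) then c x y * (v x - v y) ^ 2 else 0)
      = 2 * (c p q * effectiveResistance c p q ^ 2) := by
    rw [← Fintype.sum_prod_type' (f := fun x y => if s(x, y) = s(p, q) then c x y * (v x - v y) ^ 2 else 0),
      ← Finset.sum_filter]
    have hS : (Finset.univ.filter fun e : X × X => s(e.1, e.2) = s(p, q)) = {(p, q), (q, p)} := by
      ext e
      rw [Finset.mem_filter, Finset.mem_insert, Finset.mem_singleton, Sym2.eq_iff]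
      simp only [Finset.mem_univ, true_and, Prod.ext_iff]
    have hne : (p, q) ≠ (q, p) := fun h => hpq (Prod.ext_iff.1 h).1
    rw [hS, Finset.sum_pair hne]
    simp only
    rw [hc.symm q p, hR]
    ring
  have hsplit : ∑ x, ∑ y, (if s(x, y) = s(p, q) then 0 else c x y * (v x - v y) ^ 2)
      = ∑ x, ∑ y, c x y * (v x - v y) ^ 2
        - ∑ x, ∑ y, (if s(x, y) = s(p, q) then c x y * (v x - v y) ^ 2 else 0) := by
    rw [← Finset.sum_sub_distrib]
    refine Finset.sum_congr rfl fun x _ => ?_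
    rw [← Finset.sum_sub_distrib]
    refine Finset.sum_congr rfl fun y _ => ?_
    split_ifs <;> ring
  rw [hsplit, htot, hdiag, hR]
  ring

/-- ★★ **… DIVIDED BY THE LODF DENOMINATOR** (non-bridge line, `0 < 1 − c𝓡`): the `c`-weighted sum of
the squared LODF numerators per unit denominator, `ΣΣ' c(x,y)[(v_x − v_y)/(1 − c(p,q)𝓡(p ↔ q))]² =
2𝓡(p ↔ q)/(1 − c(p,q)𝓡(p ↔ q))` — with `LODF_{(xy),(pq)} = c(x,y)(v_x − v_y)/(1 − c𝓡)` this is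
`Σ_{k ≠ ℓ} LODF_{kℓ}²/b_k = 𝓡_ℓ/(1 − b_ℓ𝓡_ℓ)` over unordered lines (`= 𝓡'_ℓ`, the post-outage
resistance across the tripped terminals, `DCFlowLineOutageUpdate`).
[cite: RonellenfitschEtAl2017, §2 and §5.3 («divides each column `ℓ` by the value `1 − PTDF_{ℓℓ}`», arXiv:1606.07276 p0004 L88–L92, p0008 L31–L32); SpielmanSrivastava2011, §3 Lemma 3 (iv)] -/
theorem sum_lodf_sq_div (hc : IsConductance c) {G : SimpleGraph X}
    (hG : ∀ x y, G.Adj x y ↔ x ≠ y ∧ c x y ≠ 0) (hconn : G.Connected) {p q : X} (hpq : p ≠ q)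
    (hcpq : c p q ≠ 0) {G' : SimpleGraph X}
    (hG' : ∀ x y, G'.Adj x y → c x y ≠ 0 ∧ ¬ (x = p ∧ y = q) ∧ ¬ (x = q ∧ y = p))
    (hreach : G'.Reachable p q)
    {v : X → ℝ} (hv : (Matrix.diagonal (nodeConductance c) - c) *ᵥ v = Pi.single p 1 - Pi.single q 1) :
    0 < 1 - c p q * effectiveResistance c p q
    ∧ ∑ x, ∑ y, (if s(x, y) = s(p, q) then 0
        else c x y * ((v x - v y) / (1 - c p q * effectiveResistance c p q)) ^ 2)
      = 2 * effectiveResistance c p q / (1 - c p q * effectiveResistance c p q) := by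
  have hlt := conductance_mul_effectiveResistance_lt_one hc hG hconn hpq hcpq hG' hreach
  have hpos : 0 < 1 - c p q * effectiveResistance c p q := by linarith
  refine ⟨hpos, ?_⟩
  have h := sum_conductance_mul_transferPotential_sub_sq_off hc hG hconn hpq hv
  have hscale : ∑ x, ∑ y, (if s(x, y) = s(p, q) then 0
        else c x y * ((v x - v y) / (1 - c p q * effectiveResistance c p q)) ^ 2)
      = (∑ x, ∑ y, (if s(x, y) = s(p, q) then 0 else c x y * (v x - v y) ^ 2))
          / (1 - c p q * effectiveResistance c p q) ^ 2 := by
    rw [Finset.sum_div]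
    refine Finset.sum_congr rfl fun x _ => ?_
    rw [Finset.sum_div]
    refine Finset.sum_congr rfl fun y _ => ?_
    split_ifs
    · rw [zero_div]
    · rw [div_pow, mul_div_assoc]
  rw [hscale, h, div_eq_div_iff (pow_ne_zero 2 hpos.ne') hpos.ne']
  ring

end Projection

/-! ### §3. Lemma 3 (iii) / Foster's theorem on a connected network: the self-factor budget, the N−1
margin budget, and Markov counts -/

section Trace

/-- ★★★ **FOSTER'S THEOREM ON A CONNECTED NETWORK / `Tr Π = n − 1`**: `Σ_xΣ_y c(x,y)𝓡(x ↔ y) = 2(n −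
1)` («Since `Σ_e w_eR_e = Tr(Π) = n − 1` by Lemma 3 (iii)»; each line twice in the double sum, loops
and non-lines contribute `0`) — the tree's `LyonsPeres2016_ex_4_29` (irreducible network) under the
connected-graph hypothesis of the power-systems files.
[cite: SpielmanSrivastava2011, §3 Lemma 3 (iii) and proof of Thm 1 (arXiv:0803.0929 p0006 L9–L10, L39–L43, L135–L137); LyonsPeres2016, §4.6 Exercise 4.29, §2.11 Exercise 2.65 (Foster 1948)] -/
theorem sum_conductance_mul_effectiveResistance (hc : IsConductance c) {G : SimpleGraph X}
    (hG : ∀ x y, G.Adj x y ↔ x ≠ y ∧ c x y ≠ 0) (hconn : G.Connected) :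
    ∑ x, ∑ y, c x y * effectiveResistance c x y = 2 * ((Fintype.card X : ℝ) - 1) := by
  haveI : Nonempty X := hconn.nonempty
  have hirr := isIrreducible_networkKernel_of_connected hc hG hconn
  have h := LyonsPeres2016_ex_4_29 hc hirr
  linarith

/-- ★★★ **THE SELF-FACTORS OF ALL LINES SUM TO `n − 1`**: for any family of transfer potentials of the
ordered lines, `Σ_pΣ_q c(p,q)(v^{pq}_p − v^{pq}_q) = 2(n − 1)` — the diagonal `[PTDF·K]_{ℓℓ} = Π(ℓ,ℓ) =
w_ℓR_ℓ` summed over all lines is `n − 1` whatever the conductances (so the MEAN self-PTDF of a line is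
`(n − 1)/m`).
[cite: SpielmanSrivastava2011, §3 («`Π(e,e) = w_eR_e`», Lemma 3 (iii), «`Σ_e w_eR_e = Tr(Π) = n − 1`», arXiv:0803.0929 p0006 L3–L10, L135–L137); RonellenfitschEtAl2017, §2, §5.3 (`PTDF_{ℓℓ}`, arXiv:1606.07276 p0004 L88–L95, p0008 L32)] -/
theorem sum_selfTransferFactor (hc : IsConductance c) {G : SimpleGraph X}
    (hG : ∀ x y, G.Adj x y ↔ x ≠ y ∧ c x y ≠ 0) (hconn : G.Connected) {v : X → X → X → ℝ}
    (hv : ∀ p q, p ≠ q → c p q ≠ 0 →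
      (Matrix.diagonal (nodeConductance c) - c) *ᵥ v p q = Pi.single p 1 - Pi.single q 1) :
    ∑ p, ∑ q, c p q * (v p q p - v p q q) = 2 * ((Fintype.card X : ℝ) - 1) := by
  rw [← sum_conductance_mul_effectiveResistance hc hG hconn]
  refine Finset.sum_congr rfl fun p _ => Finset.sum_congr rfl fun q _ => ?_
  by_cases hpq : p = q
  · subst hpq; rw [effectiveResistance_self, sub_self]
  by_cases hcpq : c p q = 0
  · rw [hcpq, zero_mul, zero_mul]
  · rw [effectiveResistance_eq_transferPotential_sub hc hG hconn hpq (hv p q hpq hcpq)]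

/-- ★★★ **FOSTER OVER THE LINE SET**: `Σ_{ordered lines (x,y)} c(x,y)𝓡(x ↔ y) = 2(n − 1)`, i.e.
`Σ_{lines ℓ} b_ℓ𝓡_ℓ = n − 1` over the physical (unordered) lines.
[cite: SpielmanSrivastava2011, §3 (arXiv:0803.0929 p0006 L135–L137); LyonsPeres2016, §4.6 Exercise 4.29 («`Σ_{e∈E_{1/2}} c(e)𝓡(e⁻ ↔ e⁺) = n − 1`»)] -/
theorem sum_lines_selfFactor (hc : IsConductance c) {G : SimpleGraph X}
    (hG : ∀ x y, G.Adj x y ↔ x ≠ y ∧ c x y ≠ 0) (hconn : G.Connected) :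
    ∑ e ∈ Finset.univ.filter (fun e : X × X => e.1 ≠ e.2 ∧ c e.1 e.2 ≠ 0),
        c e.1 e.2 * effectiveResistance c e.1 e.2 = 2 * ((Fintype.card X : ℝ) - 1) := by
  rw [Finset.sum_filter, ← sum_conductance_mul_effectiveResistance hc hG hconn,
    ← Fintype.sum_prod_type' (f := fun x y => c x y * effectiveResistance c x y)]
  refine Finset.sum_congr rfl fun e _ => ?_
  split_ifs with h
  · rfl
  · rw [not_and_or, not_ne_iff, not_ne_iff] at h
    rcases h with h | h
    · rw [h, effectiveResistance_self, mul_zero]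
    · rw [h, zero_mul]

/-- ★★ **A CONNECTED GRID HAS AT LEAST `n − 1` LINES — via Foster**: `2(n − 1) = Σ_ℓ c_ℓ𝓡_ℓ ≤
#ordered lines`, because every self-factor is at most `1` (Lemma 3 (iii): the multiplicity `m − n + 1`
of the eigenvalue `0` is non-negative).
[cite: SpielmanSrivastava2011, §3 Lemma 3 (iii) (arXiv:0803.0929 p0006 L9–L10); RonellenfitschEtAl2017, §3 («`L − N + 1` fundamental cycles», arXiv:1606.07276 p0005 L4–L11)] -/
theorem two_mul_card_sub_one_le_card_lines (hc : IsConductance c) {G : SimpleGraph X}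
    (hG : ∀ x y, G.Adj x y ↔ x ≠ y ∧ c x y ≠ 0) (hconn : G.Connected) :
    2 * ((Fintype.card X : ℝ) - 1)
      ≤ #(Finset.univ.filter (fun e : X × X => e.1 ≠ e.2 ∧ c e.1 e.2 ≠ 0)) := by
  rw [← sum_lines_selfFactor hc hG hconn]
  calc ∑ e ∈ Finset.univ.filter (fun e : X × X => e.1 ≠ e.2 ∧ c e.1 e.2 ≠ 0),
          c e.1 e.2 * effectiveResistance c e.1 e.2
        ≤ ∑ e ∈ Finset.univ.filter (fun e : X × X => e.1 ≠ e.2 ∧ c e.1 e.2 ≠ 0), (1 : ℝ) :=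
          Finset.sum_le_sum fun e he => by
            obtain ⟨hne, hce⟩ := (Finset.mem_filter.1 he).2
            exact conductance_mul_effectiveResistance_le_one hc hG hconn hne hce
    _ = _ := by rw [Finset.sum_const, nsmul_eq_mul, mul_one]

/-- ★★★ **THE N−1 MARGIN BUDGET**: `Σ_{ordered lines ℓ} (1 − c_ℓ𝓡_ℓ) = #ordered lines − 2(n − 1)`
— over physical lines `Σ_ℓ (1 − PTDF_{ℓℓ}) = m − (n − 1) = m − n + 1`, the number of independent
cycles («`0` with multiplicity `m − n + 1`»; «the `L − N + 1` cycles are a basis for the kernel of the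
incidence matrix»): the LODF denominators of a grid share a fixed budget equal to its cycle rank.
[cite: SpielmanSrivastava2011, §3 Lemma 3 (iii) (arXiv:0803.0929 p0006 L9–L10, L39–L43); RonellenfitschEtAl2017, §3 (arXiv:1606.07276 p0005 L4–L11), §5.3 (`1 − PTDF_{ℓℓ}`, p0008 L32)] -/
theorem sum_lines_one_sub_selfFactor (hc : IsConductance c) {G : SimpleGraph X}
    (hG : ∀ x y, G.Adj x y ↔ x ≠ y ∧ c x y ≠ 0) (hconn : G.Connected) :
    ∑ e ∈ Finset.univ.filter (fun e : X × X => e.1 ≠ e.2 ∧ c e.1 e.2 ≠ 0),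
        (1 - c e.1 e.2 * effectiveResistance c e.1 e.2)
      = #(Finset.univ.filter (fun e : X × X => e.1 ≠ e.2 ∧ c e.1 e.2 ≠ 0))
        - 2 * ((Fintype.card X : ℝ) - 1) := by
  rw [Finset.sum_sub_distrib, sum_lines_selfFactor hc hG hconn, Finset.sum_const, nsmul_eq_mul,
    mul_one]

/-- ★★ **MARKOV COUNT OF STIFF LINES**: for `t > 0`, `t · #{ordered lines ℓ : t ≤ c_ℓ𝓡_ℓ} ≤ 2(n −
1)` — at most `(n − 1)/t` physical lines can have self-factor `PTDF_{ℓℓ} ≥ t` (with `t = 1`: at most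
`n − 1` bridges).
[cite: SpielmanSrivastava2011, §3 Lemma 3 (iii), «`Σ_e w_eR_e = n − 1`» (arXiv:0803.0929 p0006 L135–L137)] [folklore (Markov's inequality on the budget)] -/
theorem mul_card_lines_selfFactor_ge_le (hc : IsConductance c) {G : SimpleGraph X}
    (hG : ∀ x y, G.Adj x y ↔ x ≠ y ∧ c x y ≠ 0) (hconn : G.Connected) {t : ℝ} (ht : 0 < t) :
    t * #(Finset.univ.filter (fun e : X × X =>
        e.1 ≠ e.2 ∧ c e.1 e.2 ≠ 0 ∧ t ≤ c e.1 e.2 * effectiveResistance c e.1 e.2))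
      ≤ 2 * ((Fintype.card X : ℝ) - 1) := by
  have hirr := isIrreducible_networkKernel_of_connected hc hG hconn
  rw [← sum_lines_selfFactor hc hG hconn]
  set S := Finset.univ.filter (fun e : X × X => e.1 ≠ e.2 ∧ c e.1 e.2 ≠ 0) with hS
  set T := Finset.univ.filter (fun e : X × X =>
    e.1 ≠ e.2 ∧ c e.1 e.2 ≠ 0 ∧ t ≤ c e.1 e.2 * effectiveResistance c e.1 e.2) with hT
  have hTS : T ⊆ S := fun e he =>
    Finset.mem_filter.2 ⟨Finset.mem_univ _, (Finset.mem_filter.1 he).2.1, (Finset.mem_filter.1 he).2.2.1⟩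
  have ht' := ht.le
  calc t * #T = ∑ e ∈ T, t := by rw [Finset.sum_const, nsmul_eq_mul, mul_comm]
    _ ≤ ∑ e ∈ T, c e.1 e.2 * effectiveResistance c e.1 e.2 :=
        Finset.sum_le_sum fun e he => (Finset.mem_filter.1 he).2.2.2
    _ ≤ ∑ e ∈ S, c e.1 e.2 * effectiveResistance c e.1 e.2 :=
        Finset.sum_le_sum_of_subset_of_nonneg hTS fun e he _ =>
          mul_nonneg (hc.nonneg _ _)
            (effectiveResistance_pos hc hirr (Finset.mem_filter.1 he).2.1).le

/-- ★★ **FEW LINES CAN HAVE A SMALL LODF DENOMINATOR**: for `ε < 1`, `(1 − ε) · #{ordered lines ℓ :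
1 − c_ℓ𝓡_ℓ ≤ ε} ≤ 2(n − 1)` — at most `(n − 1)/(1 − ε)` physical lines have `1 − PTDF_{ℓℓ} ≤ ε`.
[cite: RonellenfitschEtAl2017, §5.3 («divides each column `ℓ` by the value `1 − PTDF_{ℓℓ}`», arXiv:1606.07276 p0008 L32); SpielmanSrivastava2011, §3 (p0006 L135–L137)] [folklore (Markov)] -/
theorem mul_card_lines_margin_le_le (hc : IsConductance c) {G : SimpleGraph X}
    (hG : ∀ x y, G.Adj x y ↔ x ≠ y ∧ c x y ≠ 0) (hconn : G.Connected) {ε : ℝ} (hε : ε < 1) :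
    (1 - ε) * #(Finset.univ.filter (fun e : X × X =>
        e.1 ≠ e.2 ∧ c e.1 e.2 ≠ 0 ∧ 1 - c e.1 e.2 * effectiveResistance c e.1 e.2 ≤ ε))
      ≤ 2 * ((Fintype.card X : ℝ) - 1) := by
  have h := mul_card_lines_selfFactor_ge_le hc hG hconn (t := 1 - ε) (by linarith)
  have hTT : Finset.univ.filter (fun e : X × X =>
        e.1 ≠ e.2 ∧ c e.1 e.2 ≠ 0 ∧ 1 - c e.1 e.2 * effectiveResistance c e.1 e.2 ≤ ε)
      = Finset.univ.filter (fun e : X × X =>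
        e.1 ≠ e.2 ∧ c e.1 e.2 ≠ 0 ∧ 1 - ε ≤ c e.1 e.2 * effectiveResistance c e.1 e.2) := by
    refine Finset.filter_congr fun e _ => ?_
    constructor
    · rintro ⟨h1, h2, h3⟩; exact ⟨h1, h2, by linarith⟩
    · rintro ⟨h1, h2, h3⟩; exact ⟨h1, h2, by linarith⟩
  rwa [hTT]

end Trace

/-! ### §4. Every line critical ⟺ the grid is a tree ⟺ Foster's count saturates -/

section Tree

/-- ★★★ **EVERY LINE IS CRITICAL IFF THE GRID IS A TREE**: on a connected network, all self-factors
equal `1` (`c(x,y)𝓡(x ↔ y) = 1` for every line — no finite LODF, the outage of any line islands the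
grid) iff the graph of lines is a tree.  (`c𝓡 = 1 ⟺` the line is a bridge, `DCFlowLineOutageBounds`;
all lines bridges `⟺` acyclic, Mathlib.)
[cite: RonellenfitschEtAl2017, §2 («For the special case … one defines `LODF_{kk} = −1`»; `1 − PTDF_{ℓℓ}` as the divisor, arXiv:1606.07276 p0004 L88–L93, p0008 L32), §3 (`L − N + 1 = 0` cycles); SpielmanSrivastava2011, §3 Lemma 3 (iii)] [folklore] -/
theorem forall_selfFactor_eq_one_iff_isTree (hc : IsConductance c) {G : SimpleGraph X}
    (hG : ∀ x y, G.Adj x y ↔ x ≠ y ∧ c x y ≠ 0) (hconn : G.Connected) :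
    (∀ x y, x ≠ y → c x y ≠ 0 → c x y * effectiveResistance c x y = 1) ↔ G.IsTree := by
  classical
  constructor
  · intro h
    refine ⟨hconn, SimpleGraph.isAcyclic_iff_forall_adj_isBridge.2 fun x y hxy => ?_⟩
    obtain ⟨hne, hce⟩ := (hG x y).1 hxy
    exact SimpleGraph.isBridge_iff.2
      ((conductance_mul_effectiveResistance_lt_one_iff_reachable hc hG hconn hne hce).2.1
        (h x y hne hce))
  · intro hT x y hne hce
    have hbr := SimpleGraph.isAcyclic_iff_forall_adj_isBridge.1 hT.isAcyclic ((hG x y).2 ⟨hne, hce⟩)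
    exact (conductance_mul_effectiveResistance_lt_one_iff_reachable hc hG hconn hne hce).2.2
      (SimpleGraph.isBridge_iff.1 hbr)

/-- ★★★ **… IFF FOSTER'S COUNT SATURATES**: all self-factors equal `1` iff `#ordered lines = 2(n −
1)` (i.e. `m = n − 1`): the margin budget `Σ_ℓ (1 − c_ℓ𝓡_ℓ) = #lines − 2(n − 1)` is a sum of
non-negative terms.
[cite: SpielmanSrivastava2011, §3 Lemma 3 (iii) (arXiv:0803.0929 p0006 L9–L10, L135–L137); LyonsPeres2016, §4.6 Exercise 4.29] [folklore] -/
theorem card_lines_eq_iff_forall_selfFactor_eq_one (hc : IsConductance c) {G : SimpleGraph X}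
    (hG : ∀ x y, G.Adj x y ↔ x ≠ y ∧ c x y ≠ 0) (hconn : G.Connected) :
    (#(Finset.univ.filter (fun e : X × X => e.1 ≠ e.2 ∧ c e.1 e.2 ≠ 0)) : ℝ)
        = 2 * ((Fintype.card X : ℝ) - 1)
      ↔ ∀ x y, x ≠ y → c x y ≠ 0 → c x y * effectiveResistance c x y = 1 := by
  have hsum := sum_lines_one_sub_selfFactor hc hG hconn
  have hnn : ∀ e ∈ Finset.univ.filter (fun e : X × X => e.1 ≠ e.2 ∧ c e.1 e.2 ≠ 0),
      0 ≤ 1 - c e.1 e.2 * effectiveResistance c e.1 e.2 := fun e he => by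
    obtain ⟨hne, hce⟩ := (Finset.mem_filter.1 he).2
    exact sub_nonneg.2 (conductance_mul_effectiveResistance_le_one hc hG hconn hne hce)
  constructor
  · intro hcard x y hne hce
    have h0 : ∑ e ∈ Finset.univ.filter (fun e : X × X => e.1 ≠ e.2 ∧ c e.1 e.2 ≠ 0),
        (1 - c e.1 e.2 * effectiveResistance c e.1 e.2) = 0 := by
      rw [hsum, hcard, sub_self]
    have := (Finset.sum_eq_zero_iff_of_nonneg hnn).1 h0 (x, y)
      (Finset.mem_filter.2 ⟨Finset.mem_univ _, hne, hce⟩)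
    linarith
  · intro h
    have h0 : ∑ e ∈ Finset.univ.filter (fun e : X × X => e.1 ≠ e.2 ∧ c e.1 e.2 ≠ 0),
        (1 - c e.1 e.2 * effectiveResistance c e.1 e.2) = 0 :=
      Finset.sum_eq_zero fun e he => by
        obtain ⟨hne, hce⟩ := (Finset.mem_filter.1 he).2
        rw [h _ _ hne hce, sub_self]
    linarith

omit [DecidableEq X] in
/-- ★ **ORDERED LINES ARE THE DARTS OF THE GRAPH**: `#ordered lines = 2m`, `m = #E(G)` the number of
physical lines — so the statements of §3–§4 read `Σ_ℓ b_ℓ𝓡_ℓ = n − 1`, `Σ_ℓ (1 − b_ℓ𝓡_ℓ) = m − n +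
1`, `m ≥ n − 1`, and «all lines critical `⟺ m = n − 1`» over physical lines.
[cite: RonellenfitschEtAl2017, §3 (`N` nodes, `L` edges, `L − N + 1` cycles, arXiv:1606.07276 p0005 L4–L7)] [folklore] -/
theorem card_lines_eq_two_mul_card_edgeFinset [DecidableEq X] {G : SimpleGraph X} [DecidableRel G.Adj]
    (hG : ∀ x y, G.Adj x y ↔ x ≠ y ∧ c x y ≠ 0) :
    #(Finset.univ.filter (fun e : X × X => e.1 ≠ e.2 ∧ c e.1 e.2 ≠ 0)) = 2 * #G.edgeFinset := by
  rw [← SimpleGraph.dart_card_eq_twice_card_edges (G := G), ← Finset.card_univ (α := G.Dart)]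
  have hmap : (Finset.univ : Finset G.Dart).map
        ⟨SimpleGraph.Dart.toProd, SimpleGraph.Dart.toProd_injective (G := G)⟩
      = Finset.univ.filter (fun e : X × X => e.1 ≠ e.2 ∧ c e.1 e.2 ≠ 0) := by
    ext e
    rw [Finset.mem_map, Finset.mem_filter]
    constructor
    · rintro ⟨d, -, rfl⟩
      exact ⟨Finset.mem_univ _, (hG _ _).1 d.adj⟩
    · rintro ⟨-, he⟩
      exact ⟨⟨e, (hG _ _).2 he⟩, Finset.mem_univ _, rfl⟩
  rw [← hmap, Finset.card_map]

end Tree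

end KronReduction

/-! ### §5. THE MODEL: the Joule heat of a DC redistribution is `F_ℓ²` times the post-outage
resistance across the tripped terminals -/

namespace ClassicalModel

open KronReduction Literature.Probability.MarkovChains

variable {X : Type*} [Fintype X] [DecidableEq X] {c : Matrix X X ℝ}

/-- ★★★ **THE JOULE HEAT OF A REDISTRIBUTION.**  Connected lossless DC grid `c`, line `{r,s}` (`b_rs
= c(r,s) > 0`) tripped, damaged grid `c'` (same lines minus `{r,s}`) still connected, `Lθ = P` before
and `L'θ' = P` after (same injections).  With the pre-outage flow `F_rs = b_rs(θ_r − θ_s)` and the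
flow changes `ΔF_mn = b_mn[(θ'_m − θ'_n) − (θ_m − θ_n)]` on the surviving lines:
`Σ_mΣ_n c'(m,n)[(θ'_m − θ'_n) − (θ_m − θ_n)]² = 2F_rs²·𝓡'(r ↔ s)` (i.e. `Σ_{surviving lines k}
ΔF_k²/b_k = F_rs²𝓡'(r ↔ s)`: the redistribution is the unit `r → s` transfer of the DAMAGED grid
scaled by `F_rs`, and a transfer's energy is its resistance), and `𝓡'(r ↔ s) = 𝓡(r ↔ s)/(1 −
b_rs𝓡(r ↔ s))` — a severity index quadratic in the pre-outage flow times a resistance distance, the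
static counterpart of «proportional to the square of the power flowing on the line prior to the fault,
times a topological factor … the resistance distance».  DERIVED (this exact static identity is
assembled here from the cited ingredients, not quoted): energy of a transfer (§1), `L'(θ' − θ) =
F_rs ν_rs` ([StrakeEtAl2019] (11)–(12)), resistance update ([DorflerBullo2013] Thm 3.15 2)).
[cite: StrakeEtAl2019, §3.3 eqs. (11)–(12) (arXiv:1811.08683 p0005 L89–L96); SpielmanSrivastava2011, §3 Lemma 3 (iv); DorflerBullo2013, §3.4 Theorem 3.15 2) (arXiv:1102.2950 p0020 L38–L46); ColettaJacquod2019 = arXiv:1711.10348, Prop. 7 and discussion (p0013 L105–L120, p0015 L17–L22) — reading only] -/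
theorem dcFlow_lineOutage_redistributionEnergy (hc : IsConductance c) {G : SimpleGraph X}
    (hG : ∀ x y, G.Adj x y ↔ x ≠ y ∧ c x y ≠ 0) (hconn : G.Connected) {r s : X} (hrs : r ≠ s)
    (hcrs : c r s ≠ 0) {c' : Matrix X X ℝ} (hrs' : c' r s = 0) (hsr' : c' s r = 0)
    (hoff : ∀ x y, ¬ (x = r ∧ y = s) → ¬ (x = s ∧ y = r) → c' x y = c x y)
    {G' : SimpleGraph X} (hG' : ∀ x y, G'.Adj x y ↔ x ≠ y ∧ c' x y ≠ 0) (hconn' : G'.Connected)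
    {P θ θ' : X → ℝ} (hθ : (Matrix.diagonal (nodeConductance c) - c) *ᵥ θ = P)
    (hθ' : (Matrix.diagonal (nodeConductance c') - c') *ᵥ θ' = P) :
    ∑ m, ∑ n, c' m n * ((θ' m - θ' n) - (θ m - θ n)) ^ 2
        = 2 * (c r s * (θ r - θ s)) ^ 2 * effectiveResistance c' r s
    ∧ effectiveResistance c' r s
        = effectiveResistance c r s / (1 - c r s * effectiveResistance c r s) := by
  have hc' := isConductance_lineOutage hc hrs hrs' hsr' hoff hG' hconn'
  have hL' := laplacian_lineOutage_eq hc hrs hrs' hsr' hoff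
  have htr := (dcFlow_lineOutage_transfer hL' hθ hθ').2
  constructor
  · set F := c r s * (θ r - θ s) with hF
    by_cases hF0 : F = 0
    · -- no pre-outage flow on the line: nothing is redistributed
      have h0 : (Matrix.diagonal (nodeConductance c') - c') *ᵥ (θ' - θ)
          = (Matrix.diagonal (nodeConductance c') - c') *ᵥ (0 : X → ℝ) := by
        rw [htr, hF0, zero_smul, Matrix.mulVec_zero]
      obtain ⟨κ, hκ⟩ := (laplacian_mulVec_eq_mulVec_iff hc' hG' hconn' _ _).1 h0.symm
      have hconst : ∀ m n, (θ' m - θ' n) - (θ m - θ n) = 0 := fun m n => by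
        have hm := hκ m
        have hn := hκ n
        simp only [Pi.sub_apply, Pi.zero_apply] at hm hn
        linarith
      simp_rw [hconst]
      rw [hF0]
      simp
    · -- `ψ/F` is a transfer potential of the damaged grid
      have hu : (Matrix.diagonal (nodeConductance c') - c') *ᵥ (F⁻¹ • (θ' - θ))
          = Pi.single r 1 - Pi.single s 1 := by
        rw [Matrix.mulVec_smul, htr, smul_smul, inv_mul_cancel₀ hF0, one_smul]
      have hE := sum_conductance_mul_transferPotential_sub_sq hc' hG' hconn' hu
      have hterm : ∀ m n, c' m n * ((θ' m - θ' n) - (θ m - θ n)) ^ 2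
          = F ^ 2 * (c' m n * ((F⁻¹ • (θ' - θ)) m - (F⁻¹ • (θ' - θ)) n) ^ 2) := fun m n => by
        simp only [Pi.smul_apply, Pi.sub_apply, smul_eq_mul]
        field_simp
        ring
      simp_rw [hterm]
      rw [← Finset.sum_congr rfl fun m _ => (Finset.mul_sum _ _ _), ← Finset.mul_sum, hE]
      ring
  · obtain ⟨v, hv⟩ := exists_transferPotential hc hG hconn r s
    obtain ⟨hpos, hR', -, -⟩ :=
      effectiveResistance_lineOutage_eq hc hG hconn hrs hcrs hrs' hsr' hoff hG' hconn' hrs hv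
    have hne : 1 - c r s * effectiveResistance c r s ≠ 0 := hpos.ne'
    rw [hR', ← effectiveResistance_eq_transferPotential_sub hc hG hconn hrs hv, eq_div_iff hne, add_mul,
      div_mul_cancel₀ _ hne]
    ring

end ClassicalModel

end Literature.MathematicalPhysics.PowerSystems

end
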